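import Summits.BirchSwinnertonDyer.BirchSwinnertonDyer.Theorems.KimAtThreeFineKatoPerFactorDefined
import Summits.BirchSwinnertonDyer.BirchSwinnertonDyer.Theorems.KimAtThreeFineKatoLevelCompatTwist
import HarnessLib

/-!
# Crux `KatoKuriharaPortThreeShared` (stmt-BirchSwinnertonDyer-19560): the per-factor defined-Kato package
# with the TWISTED localisations — `hKdefσ ⟹ hKloc` (cell `bsd-addord`, seat w2-acc5 gen 5; route W2
# `KimAtThreeKolyvagin`; `--supports 19560`, helper; the LEAD kim3 gen 14 assembles)

HONEST FRAMING.  TOOL theorems only (no definition, no named fact, no `sorry`); closes nothing; nothing is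
booked; BSD is not proved by any of this.  `hKdefσ` is a DISPLAYED hypothesis.

WHY THIS FILE (finding of record, HOME STATUS 2026-08-27 ≈05:45Z, w2-acc5 g5).  The LEAD's fold
`KimAtThreeFineKatoPerFactorDefined.perFactorKatoPackage_of_perFactorDefined : hKdef → hKloc` displays the
definitional clause (DEF_w) «`Ψ(Λ_{0,r} [φ''])_w = φ'_w [φ'' ∘ t_w]`» with the UNTWISTED tower restriction
`t_w : Γ_{L_w} → Γ_{ℚ_{v₀}} → Γ_ℚ`.  But `t_w` lands in `U ⊓ D_{𝔓₀}` for the ONE prime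
`𝔓₀ = adicCompletionPrime ℚ v₀` whatever the factor `w ∣ 3` is
(`LevelFieldLocalization.absGaloisRestrictTower_mem_decompositionSubgroup`: the middle field `ℚ_{v₀}` is
fixed, `F = L_w` is arbitrary), so a `Λ_{0,r}` satisfying (DEF_w) reads EVERY factor at the same place
`w₀* = 𝔓₀ ∩ ℚ(μ_m)` of the level field.  Kato's value datum `Λ = exp* ∘ loc_p` on the semi-local
cohomology `⊕_{w ∣ p} H¹(L_w, T)` has `w`-component the localisation AT `w`; at a level `m` with
`g(m) = φ(m)/ord_m(3) ≥ 2` places above `3` (e.g. `m = 13`, `g = 4`) the two differ — with `φ'_w` the true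
`exp*_{L_w}`, the Λ pinned by (DEF_w) sends Kato's `z_{0,r}` to `Ψ⁻¹((ι_w(γ_w · x_{0,r}))_w)`,
`γ_w ∈ Gal(ℚ(ζ_m)/ℚ)` moving `w₀*` to `w`, not to `1 ⊗ x_{0,r}`: `ZetaBody` (C4) fails for it, and so does
(C3a) for `σ̃ ∉ D(w₀*)`.  So `hKdef` = {(DEF_w) untwisted} ∧ {(g) `ZetaBody (Λ)`} is not what Kato 2004 +
[BK90] supply.  The `g` distinct places are reached by the TWISTS `loc^{tower}_w ∘ conjMap σ_w`,
`σ_w ∈ Γ_ℚ` (`KimAtThreeFineKatoLevelCompatTwist`, p498449: a level class is not `Γ_ℚ`-invariant;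
`(σ · y)|_{D_{𝔓₀}}` is `y` at `σ⁻¹𝔓₀`), and the `σ_w` realising the place `w` of the model exists
(`KimAtThreeFineKatoLevelTwistChoice`, p499155).  The COMPAT implication itself is twist-blind
(`Λ^σ_w y − Λ¹_w y ∈ φ'_w(t_w^*(ker π_{j+1,*})) ⊆ 3^{j+1}·Mʷ` by level exactness), which is why both folds
type-check; the twist matters for the TRUTH of the displayed (g).

WHAT.
* §1 `exists_sub_eq_zsmul_apply_of_factorDef_conjMap` — w2-acc5 g4's per-factor COMPAT Galois side
  (`KimAtThreeFineKatoLevelCompatFactor.exists_sub_eq_zsmul_apply_of_factorDef`, p496279) for the TWISTED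
  definitional clause (DEF_w^σ) «for every cocycle `φ'` REPRESENTING `conjMap σ y` and its tower cocycle
  `ψT`, `L_F y = φ_F [ψT]`», any `σ ∈ Γ_ℚ`, every `p`, `v`, `j`, `(k, r)`, `F` (proof: the untwisted theorem
  at `σ · y` with `L_F ∘ conjMap σ⁻¹`, `res_U κ₀ = Ψ′(σ · y)` by `resSubgroup_eq_levelMap_conjMap`).
* §2 **`perFactorKatoPackage_of_perFactorDefinedTwist : hKdefσ → hKloc`**, where `hKdefσ` is the LEAD's
  `hKdef` VERBATIM except that the per-`(j, r, Ψ)` existential also displays a twist family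
  `ς : v₀.Extension(𝓞 L) → Γ_ℚ` (NO condition on it) and (DEF_w) reads
  «`oneCocycleClass φ'' = conjMap (tateRep W 3).toTopRep U (ς w) 1 y → (∀ τ, ψT τ = φ'' (t_w τ)) →
  Ψ (Λ 0 r y)_w = φ'_w [ψT]`» — Kato-v2's definition `Λ(y)_w := exp*_w (loc^{tower}_w (H1toInt (ς w · y)))`
  read on cocycles.  `hKdef ⟹ hKdefσ` (`ς := 1`, `ConjugationDescent.conjMap_one_one`), so nothing landed is
  lost; `hKdefσ` with `ς` chosen by p499155 is what a DEFINED `exp*` (w2-c2 g8 `expStarOmega hp t_w d`)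
  honestly satisfies together with `ZetaBody`.

READING FOR THE RESIDUAL OF RECORD.  **19560 ⟸ ⟨C1⟩ ⟸ hKloc ⟸ hKdefσ**; `hKdefσ` displays exactly what
`hKdef` displays (kim3 g14's list: (a) R-κ; (b)(c) hker/hdual; (d) log-lattice + unit-trace point; (e)
`exp*`-lattice; `φ'_w` with (LAT_w)/(RES_w)/(DEF_w^σ); (g) `ZetaBody`) PLUS the twist family `ς`.
NOT here: any `exp*`, any logarithm, (C3a) for the twisted-defined `Λ` (the one Galois-side clause still
open; (C3b) is p498449 `locTower_H1toInt_conjMap_eq_zero_of_forall_primesAbove`), the crux composition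
(sibling file, route cone).

References: K. Kato, Astérisque 295 (2004) §9.4, Thm. 9.7 [Kato2004Asterisque]; J.-P. Serre, *Local
Fields* (1979) VII §5 (the `G/H`-action on `H¹(H, A)`) [SerreLocalFields1979]; S. Bloch, K. Kato (1990) §3
Prop. 3.8, Ex. 3.11 [BlochKato1990]; C.-H. Kim, AJM 148 (2026) §3.4.1 and the proof of Thm. 3.13
[Kim2022StructureSelmer]; K. Rubin, *Euler Systems* (2000) Ch. III §2.1 [Rubin2000]; kim3 memo
KIM3-W2-C1c-SEMILOCAL-g14 §2; w2-acc5 g4 STATUS 2026-08-27T05:00Z (PRECISION) and g5 ≈05:45Z (FINDING).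
-/

noncomputable section

-- the cell's Theorems namespace `Summit.BirchSwinnertonDyer.BirchSwinnertonDyer.…` repeats the summit name by design (D-0017)
set_option linter.dupNamespace false

open scoped Classical NumberField TensorProduct ContRepresentation
open Field NumberField IsDedekindDomain
open WeierstrassCurve Literature.NumberTheory.EllipticCurves Literature.NumberTheory.GaloisRepresentations
  Literature.NumberTheory.GaloisRepresentations.DiscreteGaloisModule Literature.NumberTheory.GaloisCohomology
open Literature.NumberTheory.EllipticCurves.ModularForms Literature.NumberTheory.EllipticCurves.Rank1Residual
open Literature.NumberTheory.EllipticCurves.Kato2004 Literature.NumberTheory.EllipticCurves.Kato2004.EulerSystemValues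
open Literature.NumberTheory.AdelicBaseChange
open Summit.BirchSwinnertonDyer.Rank1Residual.GaloisImage
open Summit.BirchSwinnertonDyer.Rank1Residual.Additive.LocalLog
open Summit.BirchSwinnertonDyer.BirchSwinnertonDyer.Theorems
open Summit.BirchSwinnertonDyer.BirchSwinnertonDyer.Theorems.KimAtThreeFineKatoLevelCompat
open Summit.BirchSwinnertonDyer.BirchSwinnertonDyer.Theorems.KimAtThreeFineKatoLevelCompatFactor
open Summit.BirchSwinnertonDyer.BirchSwinnertonDyer.Theorems.KimAtThreeFineKatoLevelCompatTwist
open Summit.BirchSwinnertonDyer.BirchSwinnertonDyer.Theorems.KimAtThreeFineKatoPerFactorDefined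

namespace Summit.BirchSwinnertonDyer.BirchSwinnertonDyer.Theorems.KimAtThreeFineKatoPerFactorDefinedTwist

/-! ### §1. Per-factor COMPAT, Galois side, for the TWISTED definitional clause (every `p`, `v`, `F`) -/

section General

variable (W : WeierstrassCurve ℚ) [W.IsElliptic] (p : ℕ) [hp : Fact p.Prime]
  [ContinuousSMul ℤ_[p] (W.tateModule p)] (j k : ℕ) (r : Finset (HeightOneSpectrum (𝓞 ℚ)))
  (v : HeightOneSpectrum (𝓞 ℚ)) (F : Type) [Field F] [Algebra (Place.Completion (Sum.inr v)) F]

/-- **Per-factor COMPAT, Galois side, for the twisted definition `L_F = φ_F ∘ loc^{tower} ∘ (σ · )`.**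
For a field `F ⊇ ℚ_v` whose tower restriction lands in the level `U = cycSubgroup p k r`, `σ ∈ Γ_ℚ`,
additive `φ_F` on `H¹(Γ_F, T_pE)` (tower action), `L_F` on `H¹(U, T_pE)` and `e` on `H¹(ℚ_v, T_pE)` with
(DEF_w^σ) «`L_F y = φ_F [ψT]` for every cocycle `φ'` representing `σ · y` and its tower cocycle `ψT`» and
(RES_w) `φ_F (res_{F/ℚ_v} h) = e h`: whenever `res_U κ₀ = Ψ′ y` (`Ψ′` computed on cocycles by `π_{j+1}`)
and `loc_v κ₀ = π_{j+1,*} h`, **`e h − L_F y = p^{j+1} · φ_F y′` for some `y′ ∈ H¹(Γ_F, T_pE)`** — the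
untwisted theorem (p496279) at `σ · y` with `L_F ∘ (σ⁻¹ · )`, since `res_U κ₀ = Ψ′ (σ · y)` as well
(`resSubgroup_eq_levelMap_conjMap`: global classes are `Γ_ℚ`-invariant on `H¹(U, ·)`).
[cite: Kim2022StructureSelmer, §3.4.1 and the proof of Thm. 3.13 (arXiv v3 pp. 26–27)]
[cite: SerreLocalFields1979, VII §5 Prop. 3] -/
theorem exists_sub_eq_zsmul_apply_of_factorDef_conjMap (σ : absoluteGaloisGroup ℚ)
    (hU : ∀ τ, absGaloisRestrictTower ℚ (Place.Completion (Sum.inr v)) F τ ∈ cycSubgroup p k r)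
    {V : Type} [AddCommGroup V]
    (φF : ((tateLocalRep W p (Sum.inr v)).restrict
      (absGaloisRestrict (Place.Completion (Sum.inr v)) F)).cohomology 1 →+ V)
    (LF : H1 (tateRep W p) (cycSubgroup p k r) →+ V)
    (e : (tateLocalRep W p (Sum.inr v)).cohomology 1 →+ V)
    (hdef : ∀ (y : H1 (tateRep W p) (cycSubgroup p k r))
        (φ' : contOneCocycles (subgroupRep (tateRep W p).toTopRep (cycSubgroup p k r))),
        oneCocycleClass _ φ' = conjMap (tateRep W p).toTopRep (cycSubgroup p k r) σ 1 y →
        ∀ ψT : contOneCocycles ((tateLocalRep W p (Sum.inr v)).restrict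
            (absGaloisRestrict (Place.Completion (Sum.inr v)) F)).toTopRep,
          (∀ τ, ψT.1 τ = φ'.1 ⟨absGaloisRestrictTower ℚ (Place.Completion (Sum.inr v)) F τ, hU τ⟩) →
          LF y = φF (oneCocycleClass _ ψT))
    (hres : ∀ h : (tateLocalRep W p (Sum.inr v)).cohomology 1,
      φF (ContinuousRep.cohomologyRes (tateLocalRep W p (Sum.inr v))
        (absGaloisRestrict (Place.Completion (Sum.inr v)) F) 1 h) = e h)
    (Ψ : H1 (tateRep W p) (cycSubgroup p k r) →+
        continuousCohomology 1 (subgroupRep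
          (W.torsionGaloisModule ((p : ℤ) ^ j * (p : ℤ))).toTopRep (cycSubgroup p k r)))
    (hΨ : ∀ (φ' : contOneCocycles (subgroupRep (tateRep W p).toTopRep (cycSubgroup p k r)))
        (ψ : contOneCocycles (subgroupRep
          (W.torsionGaloisModule ((p : ℤ) ^ j * (p : ℤ))).toTopRep (cycSubgroup p k r))),
        (∀ g, ((ψ.1 g : geomTorsion W ((p : ℤ) ^ j * (p : ℤ))) : geomPoints W) =
          TateModule.proj p (j + 1) (φ'.1 g)) →
        Ψ (oneCocycleClass _ φ') = oneCocycleClass _ ψ)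
    (y : H1 (tateRep W p) (cycSubgroup p k r))
    (κ₀ : galoisCohomology (W.torsionGaloisModule ((p : ℤ) ^ j * (p : ℤ))) 1)
    (h : (tateLocalRep W p (Sum.inr v)).cohomology 1)
    (hresκ : resSubgroup (W.torsionGaloisModule ((p : ℤ) ^ j * (p : ℤ))).toTopRep (cycSubgroup p k r) 1 κ₀ =
      Ψ y)
    (hloc : galoisCohomology.localization (W.torsionGaloisModule ((p : ℤ) ^ j * (p : ℤ))) (Sum.inr v) 1 κ₀ =
      tateLocalMap W p j (Sum.inr v) h) :
    ∃ y' : ((tateLocalRep W p (Sum.inr v)).restrict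
        (absGaloisRestrict (Place.Completion (Sum.inr v)) F)).cohomology 1,
      e h - LF y = ((p : ℤ) ^ (j + 1)) • φF y' := by
  -- `L_F ∘ (σ⁻¹ · )`, an additive map with `(L_F ∘ (σ⁻¹ · )) (σ · y) = L_F y`
  let LF₁ : H1 (tateRep W p) (cycSubgroup p k r) →+ V :=
    LF.comp (conjMap (tateRep W p).toTopRep (cycSubgroup p k r) σ⁻¹ 1).hom.toLinearMap.toAddMonoidHom
  have hLF₁ : ∀ y₁, LF₁ y₁ = LF (conjMap (tateRep W p).toTopRep (cycSubgroup p k r) σ⁻¹ 1 y₁) :=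
    fun _ => rfl
  have hback : conjMap (tateRep W p).toTopRep (cycSubgroup p k r) σ⁻¹ 1
      (conjMap (tateRep W p).toTopRep (cycSubgroup p k r) σ 1 y) = y := by
    rw [conjMap_conjMap, inv_mul_cancel, conjMap_one_one]
  -- the untwisted theorem at `σ · y`
  obtain ⟨y', hy'⟩ := exists_sub_eq_zsmul_apply_of_factorDef W p j k r v F hU φF LF₁ e
    (fun y₁ φ' hφ' ψT hψT => by
      rw [hLF₁]
      refine hdef _ φ' ?_ ψT hψT
      rw [conjMap_conjMap, mul_inv_cancel, conjMap_one_one]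
      exact hφ')
    hres Ψ hΨ (conjMap (tateRep W p).toTopRep (cycSubgroup p k r) σ 1 y) κ₀ h
    (resSubgroup_eq_levelMap_conjMap W p j k r Ψ hΨ σ y κ₀ hresκ) hloc
  refine ⟨y', ?_⟩
  rw [← hy', hLF₁, hback]

end General

/-! ### §2. `hKdefσ ⟹ hKloc`: the per-factor package from the TWISTED per-factor definition -/

/-- **The registered stub's package `hKloc` FROM `hKdefσ`** — the LEAD's `hKdef`
(`KimAtThreeFineKatoPerFactorDefined.perFactorKatoPackage_of_perFactorDefined`) VERBATIM except that the
per-`(j, r, Ψ)` data display, next to `(Λ₀ʷ, Mʷ, φ'_w)`, a TWIST FAMILY `ς : v₀.Extension(𝓞 L) → Γ_ℚ`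
(no condition) and the definitional clause reads (DEF_w^σ) «`[φ''] = conjMap _ U (ς w) 1 y →
(∀ τ, ψT τ = φ'' (t_w τ)) → Ψ (Λ 0 r y)_w = φ'_w [ψT]`» — Kato-v2's
`Λ(y)_w := exp*_w (loc^{tower}_w (H1toInt (ς w · y)))`, the localisation AT the place `w` when `ς w` is
chosen by `KimAtThreeFineKatoLevelTwistChoice` (p499155).  Per factor the COMPAT implication is §1 with
`σ := ς w`, `F := L_w`, `L_F := (Ψ ∘ Λ 0 r)_w`, `e := algebraMap ∘ e₃ ∘ φ`; the rest is the LEAD's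
`hΨ`-bookkeeping, unchanged.  `hKdef ⟹ hKdefσ` (`ς := 1`).  `hKdefσ` displayed; closes nothing.
[cite: Kato2004Asterisque, §9.4 and Thm. 9.7 (pp. 188–189)]
[cite: Kim2022StructureSelmer, §3.4.1 and the proof of Thm. 3.13 (arXiv v3 pp. 26–27)]
[cite: SerreLocalFields1979, VII §5 Prop. 3] -/
theorem perFactorKatoPackage_of_perFactorDefinedTwist
    (hKdefσ : ∀ (W : WeierstrassCurve ℚ) [W.IsElliptic] [W.IsGloballyMinimal]
      [ContinuousSMul ℤ_[3] (W.tateModule 3)] [Module.Free ℤ_[3] (W.tateModule 3)]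
      [Module.Finite ℤ_[3] (W.tateModule 3)],
      (∀ m : ℕ, W.HasSurjectiveModNGaloisRep (3 ^ m : ℕ)) →
      (haveI : Fact (Nat.Prime 3) := ⟨Nat.prime_three⟩; Addv W 3) →
      ¬ 3 ∣ (W.baseChange ℚ_[3]).localTamagawaNumber ℤ_[3] →
      Nat.card {Q : (W.baseChange ℚ_[3]).toAffine.Point // (3 : ℕ) • Q = 0} = 1 →
      ∀ {N : ℕ} [NeZero N] (P : ModularParametrizationData W N), N = W.conductorNorm ℤ →
        (∀ z ∈ P.L.lattice, ∃ w ∈ periodLattice P.f, z = P.c * w) →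
        ¬ (3 : ℤ) ∣ P.maninConstant →
        ∃ (ι : (n : ℕ) → (CyclotomicField n ℚ →+* ℂ)) (κK : ℝ)
          (Λ : ∀ (k' : ℕ) (r : Finset (HeightOneSpectrum (𝓞 ℚ))),
            H1 (tateRep W 3) (cycSubgroup 3 k' r) →ₗ[ℤ_[3]]
              ℚ_[3] ⊗[ℚ] CyclotomicField (cycLevel 3 k' r) ℚ)
          (φ : (tateLocalRep W 3 (Sum.inr ((Rat.HeightOneSpectrum.primesEquiv (R := 𝓞 ℚ)).symm ⟨3, Fact.out⟩))).cohomology 1 →+ ℚ_[3]),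
          κK ≠ 0 ∧ (∃ u : ℚ, (u : ℝ) = κK ∧ padicValRat 3 u = 0) ∧
          (∀ y, φ y = 0 ↔ ∀ j : ℕ, tateLocalMap W 3 j (Sum.inr ((Rat.HeightOneSpectrum.primesEquiv (R := 𝓞 ℚ)).symm ⟨3, Fact.out⟩)) y ∈
            W.kummerSelmerStructure (((3 : ℕ) : ℤ) ^ j * ((3 : ℕ) : ℤ)) (Sum.inr ((Rat.HeightOneSpectrum.primesEquiv (R := 𝓞 ℚ)).symm ⟨3, Fact.out⟩))) ∧
          (∀ a : ℚ_[3], (∃ y, φ y = a) ↔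
            ∀ Q : (W.baseChange ℚ_[3]).toAffine.Point, ‖a * padicLog (W.baseChange ℚ_[3]) Q‖ ≤ 1) ∧
          (∀ (j : ℕ) (r : Finset (HeightOneSpectrum (𝓞 ℚ)))
            (Ψ : ℚ_[3] ⊗[ℚ] CyclotomicField (cycLevel 3 0 r) ℚ ≃ₐ[ℚ]
              (Π w : ((Rat.HeightOneSpectrum.primesEquiv (R := 𝓞 ℚ)).symm ⟨3, Fact.out⟩).Extension
                (𝓞 (CyclotomicField (cycLevel 3 0 r) ℚ)), w.1.adicCompletion (CyclotomicField (cycLevel 3 0 r) ℚ))),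
            (∀ (s : ℚ_[3]) (x : CyclotomicField (cycLevel 3 0 r) ℚ)
              (w : ((Rat.HeightOneSpectrum.primesEquiv (R := 𝓞 ℚ)).symm ⟨3, Fact.out⟩).Extension
                (𝓞 (CyclotomicField (cycLevel 3 0 r) ℚ))),
              Ψ (s ⊗ₜ[ℚ] x) w =
                algebraMap (CyclotomicField (cycLevel 3 0 r) ℚ) (w.1.adicCompletion (CyclotomicField (cycLevel 3 0 r) ℚ)) x *
                algebraMap (((Rat.HeightOneSpectrum.primesEquiv (R := 𝓞 ℚ)).symm ⟨3, Fact.out⟩).adicCompletion ℚ)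
                  (w.1.adicCompletion (CyclotomicField (cycLevel 3 0 r) ℚ)) (Padic.adicCompletionEquiv (𝓞 ℚ) ⟨3, Fact.out⟩ s)) →
            ∃ (Λ₀' M' : ∀ w : ((Rat.HeightOneSpectrum.primesEquiv (R := 𝓞 ℚ)).symm ⟨3, Fact.out⟩).Extension
                (𝓞 (CyclotomicField (cycLevel 3 0 r) ℚ)), Set (w.1.adicCompletion (CyclotomicField (cycLevel 3 0 r) ℚ)))
              (φ' : ∀ w : ((Rat.HeightOneSpectrum.primesEquiv (R := 𝓞 ℚ)).symm ⟨3, Fact.out⟩).Extension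
                (𝓞 (CyclotomicField (cycLevel 3 0 r) ℚ)),
                ((tateLocalRep W 3 (Sum.inr ((Rat.HeightOneSpectrum.primesEquiv (R := 𝓞 ℚ)).symm ⟨3, Fact.out⟩))).restrict
                  (absGaloisRestrict (((Rat.HeightOneSpectrum.primesEquiv (R := 𝓞 ℚ)).symm ⟨3, Fact.out⟩).adicCompletion ℚ)
                    (w.1.adicCompletion (CyclotomicField (cycLevel 3 0 r) ℚ)))).cohomology 1 →+ w.1.adicCompletion (CyclotomicField (cycLevel 3 0 r) ℚ))
              (ς : ((Rat.HeightOneSpectrum.primesEquiv (R := 𝓞 ℚ)).symm ⟨3, Fact.out⟩).Extension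
                (𝓞 (CyclotomicField (cycLevel 3 0 r) ℚ)) → absoluteGaloisGroup ℚ),
              (∀ w, Λ₀' w ⊆ w.1.adicCompletionIntegers (CyclotomicField (cycLevel 3 0 r) ℚ)) ∧
              (∀ w, (0 : w.1.adicCompletion (CyclotomicField (cycLevel 3 0 r) ℚ)) ∈ Λ₀' w) ∧
              (∃ w₀, ∃ ℓ₀ ∈ Λ₀' w₀, ‖(Padic.adicCompletionEquiv (𝓞 ℚ) ⟨3, Fact.out⟩).symm
                (Algebra.trace (((Rat.HeightOneSpectrum.primesEquiv (R := 𝓞 ℚ)).symm ⟨3, Fact.out⟩).adicCompletion ℚ)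
                  (w₀.1.adicCompletion (CyclotomicField (cycLevel 3 0 r) ℚ)) ℓ₀)‖ = 1) ∧
              (∀ w, ∀ μ ∈ M' w, ∀ ℓ ∈ Λ₀' w, ‖(Padic.adicCompletionEquiv (𝓞 ℚ) ⟨3, Fact.out⟩).symm
                (Algebra.trace (((Rat.HeightOneSpectrum.primesEquiv (R := 𝓞 ℚ)).symm ⟨3, Fact.out⟩).adicCompletion ℚ)
                  (w.1.adicCompletion (CyclotomicField (cycLevel 3 0 r) ℚ)) (μ * ℓ))‖ ≤ 1) ∧
              (∀ w z, φ' w z ∈ M' w) ∧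
              (∀ (w : ((Rat.HeightOneSpectrum.primesEquiv (R := 𝓞 ℚ)).symm ⟨3, Fact.out⟩).Extension
                (𝓞 (CyclotomicField (cycLevel 3 0 r) ℚ)))
                (h : (tateLocalRep W 3 (Sum.inr ((Rat.HeightOneSpectrum.primesEquiv (R := 𝓞 ℚ)).symm ⟨3, Fact.out⟩))).cohomology 1),
                φ' w (ContinuousRep.cohomologyRes (tateLocalRep W 3 (Sum.inr ((Rat.HeightOneSpectrum.primesEquiv (R := 𝓞 ℚ)).symm ⟨3, Fact.out⟩)))
                    (absGaloisRestrict (((Rat.HeightOneSpectrum.primesEquiv (R := 𝓞 ℚ)).symm ⟨3, Fact.out⟩).adicCompletion ℚ)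
                      (w.1.adicCompletion (CyclotomicField (cycLevel 3 0 r) ℚ))) 1 h) =
                  algebraMap (((Rat.HeightOneSpectrum.primesEquiv (R := 𝓞 ℚ)).symm ⟨3, Fact.out⟩).adicCompletion ℚ) (w.1.adicCompletion (CyclotomicField (cycLevel 3 0 r) ℚ))
                    (Padic.adicCompletionEquiv (𝓞 ℚ) ⟨3, Fact.out⟩ (φ h))) ∧
              (∀ (w : ((Rat.HeightOneSpectrum.primesEquiv (R := 𝓞 ℚ)).symm ⟨3, Fact.out⟩).Extension
                (𝓞 (CyclotomicField (cycLevel 3 0 r) ℚ)))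
                (y : H1 (tateRep W 3) (cycSubgroup 3 0 r))
                (φ'' : contOneCocycles (subgroupRep (tateRep W 3).toTopRep (cycSubgroup 3 0 r)))
                (ψT : contOneCocycles ((tateLocalRep W 3 (Sum.inr ((Rat.HeightOneSpectrum.primesEquiv (R := 𝓞 ℚ)).symm ⟨3, Fact.out⟩))).restrict
                    (absGaloisRestrict (((Rat.HeightOneSpectrum.primesEquiv (R := 𝓞 ℚ)).symm ⟨3, Fact.out⟩).adicCompletion ℚ)
                      (w.1.adicCompletion (CyclotomicField (cycLevel 3 0 r) ℚ)))).toTopRep),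
                  oneCocycleClass _ φ'' = conjMap (tateRep W 3).toTopRep (cycSubgroup 3 0 r) (ς w) 1 y →
                  (∀ σ, ψT.1 σ = φ''.1 ⟨absGaloisRestrictTower ℚ
                      (((Rat.HeightOneSpectrum.primesEquiv (R := 𝓞 ℚ)).symm ⟨3, Fact.out⟩).adicCompletion ℚ) (w.1.adicCompletion (CyclotomicField (cycLevel 3 0 r) ℚ)) σ,
                    absGaloisRestrictTower_adicCompletion_mem_cycSubgroup r w σ⟩) →
                  Ψ (Λ 0 r y) w = φ' w (oneCocycleClass _ ψT))) ∧
          ∀ (c d a : ℤ) (A : ℕ), 0 < A → Int.gcd c (6 * 3 * A) = 1 → Int.gcd d (6 * 3 * N) = 1 →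
            ∃ (z : ∀ (k' : ℕ) (r : (cyclotomicLevelsRat 3 (badPlaces c d A N)).Ideals),
                  H1 (tateRep W 3) ((cyclotomicLevelsRat 3 (badPlaces c d A N)).level k' r.1))
              (x : ∀ (k' : ℕ) (r : (cyclotomicLevelsRat 3 (badPlaces c d A N)).Ideals),
                  CyclotomicField (cycLevel 3 k' r.1) ℚ),
              ZetaBody W 3 P.f ι κK Λ c d a A z x) :
    ∀ (W : WeierstrassCurve ℚ) [W.IsElliptic] [W.IsGloballyMinimal]
      [ContinuousSMul ℤ_[3] (W.tateModule 3)] [Module.Free ℤ_[3] (W.tateModule 3)]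
      [Module.Finite ℤ_[3] (W.tateModule 3)],
      (∀ m : ℕ, W.HasSurjectiveModNGaloisRep (3 ^ m : ℕ)) →
      (haveI : Fact (Nat.Prime 3) := ⟨Nat.prime_three⟩; Addv W 3) →
      ¬ 3 ∣ (W.baseChange ℚ_[3]).localTamagawaNumber ℤ_[3] →
      Nat.card {Q : (W.baseChange ℚ_[3]).toAffine.Point // (3 : ℕ) • Q = 0} = 1 →
      ∀ (v₃ : HeightOneSpectrum (𝓞 ℚ)), ((3 : ℕ) : 𝓞 ℚ) ∈ v₃.asIdeal →
      ∀ {N : ℕ} [NeZero N] (P : ModularParametrizationData W N), N = W.conductorNorm ℤ →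
        (∀ z ∈ P.L.lattice, ∃ w ∈ periodLattice P.f, z = P.c * w) →
        ¬ (3 : ℤ) ∣ P.maninConstant →
        ∃ (ι : (n : ℕ) → (CyclotomicField n ℚ →+* ℂ)) (κK : ℝ)
          (Λ : ∀ (k' : ℕ) (r : Finset (HeightOneSpectrum (𝓞 ℚ))),
            H1 (tateRep W 3) (cycSubgroup 3 k' r) →ₗ[ℤ_[3]]
              ℚ_[3] ⊗[ℚ] CyclotomicField (cycLevel 3 k' r) ℚ)
          (φ : (tateLocalRep W 3 (Sum.inr v₃)).cohomology 1 →+ ℚ_[3]),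
          κK ≠ 0 ∧ (∃ u : ℚ, (u : ℝ) = κK ∧ padicValRat 3 u = 0) ∧
          (∀ y, φ y = 0 ↔ ∀ j : ℕ, tateLocalMap W 3 j (Sum.inr v₃) y ∈
            W.kummerSelmerStructure (((3 : ℕ) : ℤ) ^ j * ((3 : ℕ) : ℤ)) (Sum.inr v₃)) ∧
          (∀ a : ℚ_[3], (∃ y, φ y = a) ↔
            ∀ Q : (W.baseChange ℚ_[3]).toAffine.Point, ‖a * padicLog (W.baseChange ℚ_[3]) Q‖ ≤ 1) ∧
          (∀ (j : ℕ) (r : Finset (HeightOneSpectrum (𝓞 ℚ)))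
            (Ψ : ℚ_[3] ⊗[ℚ] CyclotomicField (cycLevel 3 0 r) ℚ ≃ₐ[ℚ]
              (Π w : ((Rat.HeightOneSpectrum.primesEquiv (R := 𝓞 ℚ)).symm ⟨3, Fact.out⟩).Extension
                (𝓞 (CyclotomicField (cycLevel 3 0 r) ℚ)), w.1.adicCompletion (CyclotomicField (cycLevel 3 0 r) ℚ))),
            (∀ (s : ℚ_[3]) (x : CyclotomicField (cycLevel 3 0 r) ℚ)
              (w : ((Rat.HeightOneSpectrum.primesEquiv (R := 𝓞 ℚ)).symm ⟨3, Fact.out⟩).Extension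
                (𝓞 (CyclotomicField (cycLevel 3 0 r) ℚ))),
              Ψ (s ⊗ₜ[ℚ] x) w =
                algebraMap (CyclotomicField (cycLevel 3 0 r) ℚ) (w.1.adicCompletion (CyclotomicField (cycLevel 3 0 r) ℚ)) x *
                algebraMap (((Rat.HeightOneSpectrum.primesEquiv (R := 𝓞 ℚ)).symm ⟨3, Fact.out⟩).adicCompletion ℚ)
                  (w.1.adicCompletion (CyclotomicField (cycLevel 3 0 r) ℚ)) (Padic.adicCompletionEquiv (𝓞 ℚ) ⟨3, Fact.out⟩ s)) →
            ∃ (Λ₀' M' : ∀ w : ((Rat.HeightOneSpectrum.primesEquiv (R := 𝓞 ℚ)).symm ⟨3, Fact.out⟩).Extension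
                (𝓞 (CyclotomicField (cycLevel 3 0 r) ℚ)), Set (w.1.adicCompletion (CyclotomicField (cycLevel 3 0 r) ℚ))),
              (∀ w, Λ₀' w ⊆ w.1.adicCompletionIntegers (CyclotomicField (cycLevel 3 0 r) ℚ)) ∧
              (∀ w, (0 : w.1.adicCompletion (CyclotomicField (cycLevel 3 0 r) ℚ)) ∈ Λ₀' w) ∧
              (∃ w₀, ∃ ℓ₀ ∈ Λ₀' w₀, ‖(Padic.adicCompletionEquiv (𝓞 ℚ) ⟨3, Fact.out⟩).symm
                (Algebra.trace (((Rat.HeightOneSpectrum.primesEquiv (R := 𝓞 ℚ)).symm ⟨3, Fact.out⟩).adicCompletion ℚ)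
                  (w₀.1.adicCompletion (CyclotomicField (cycLevel 3 0 r) ℚ)) ℓ₀)‖ = 1) ∧
              (∀ w, ∀ μ ∈ M' w, ∀ ℓ ∈ Λ₀' w, ‖(Padic.adicCompletionEquiv (𝓞 ℚ) ⟨3, Fact.out⟩).symm
                (Algebra.trace (((Rat.HeightOneSpectrum.primesEquiv (R := 𝓞 ℚ)).symm ⟨3, Fact.out⟩).adicCompletion ℚ)
                  (w.1.adicCompletion (CyclotomicField (cycLevel 3 0 r) ℚ)) (μ * ℓ))‖ ≤ 1) ∧
              ∀ (Ψ' : H1 (tateRep W 3) (cycSubgroup 3 0 r) →+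
                  continuousCohomology 1 (subgroupRep
                    (W.torsionGaloisModule (((3 : ℕ) : ℤ) ^ j * ((3 : ℕ) : ℤ))).toTopRep (cycSubgroup 3 0 r))),
                (∀ (φ' : contOneCocycles (subgroupRep (tateRep W 3).toTopRep (cycSubgroup 3 0 r)))
                    (ψ : contOneCocycles (subgroupRep
                      (W.torsionGaloisModule (((3 : ℕ) : ℤ) ^ j * ((3 : ℕ) : ℤ))).toTopRep (cycSubgroup 3 0 r))),
                    (∀ g, ((ψ.1 g : geomTorsion W (((3 : ℕ) : ℤ) ^ j * ((3 : ℕ) : ℤ))) : geomPoints W) =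
                      TateModule.proj 3 (j + 1) (φ'.1 g)) →
                    Ψ' (oneCocycleClass _ φ') = oneCocycleClass _ ψ) →
                ∀ (y : H1 (tateRep W 3) (cycSubgroup 3 0 r))
                  (κ₀ : galoisCohomology (W.torsionGaloisModule (((3 : ℕ) : ℤ) ^ j * ((3 : ℕ) : ℤ))) 1)
                  (h : (tateLocalRep W 3 (Sum.inr v₃)).cohomology 1),
                  resSubgroup (W.torsionGaloisModule (((3 : ℕ) : ℤ) ^ j * ((3 : ℕ) : ℤ))).toTopRep
                      (cycSubgroup 3 0 r) 1 κ₀ = Ψ' y →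
                  galoisCohomology.localization (W.torsionGaloisModule (((3 : ℕ) : ℤ) ^ j * ((3 : ℕ) : ℤ)))
                      (Sum.inr v₃) 1 κ₀ = tateLocalMap W 3 j (Sum.inr v₃) h →
                  ∀ w, ∃ μ ∈ M' w,
                    Ψ ((φ h ⊗ₜ[ℚ] (1 : CyclotomicField (cycLevel 3 0 r) ℚ)) -
                        (((3 : ℕ) : ℤ_[3]) ^ (0 : ℕ)) • Λ 0 r y) w =
                      (((3 : ℕ) : w.1.adicCompletion (CyclotomicField (cycLevel 3 0 r) ℚ)) ^ (j + 1)) * μ) ∧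
          ∀ (c d a : ℤ) (A : ℕ), 0 < A → Int.gcd c (6 * 3 * A) = 1 → Int.gcd d (6 * 3 * N) = 1 →
            ∃ (z : ∀ (k' : ℕ) (r : (cyclotomicLevelsRat 3 (badPlaces c d A N)).Ideals),
                  H1 (tateRep W 3) ((cyclotomicLevelsRat 3 (badPlaces c d A N)).level k' r.1))
              (x : ∀ (k' : ℕ) (r : (cyclotomicLevelsRat 3 (badPlaces c d A N)).Ideals),
                  CyclotomicField (cycLevel 3 k' r.1) ℚ),
              ZetaBody W 3 P.f ι κK Λ c d a A z x := by
  intro W _ _ _ _ _ htow hadd hc ht v₃ hv₃ N _ P hN hlat hman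
  -- the row's place IS the base place of `Ψ`
  have hv₃eq : v₃ = ((Rat.HeightOneSpectrum.primesEquiv (R := 𝓞 ℚ)).symm ⟨3, Fact.out⟩) := by
    have h3 := primesEquiv_eq_of_natCast_mem Nat.prime_three hv₃
    have h3' : Rat.HeightOneSpectrum.primesEquiv (R := 𝓞 ℚ) v₃ = ⟨3, Fact.out⟩ := Subtype.ext h3
    rw [← h3', Equiv.symm_apply_apply]
  subst hv₃eq
  obtain ⟨ι, κK, Λ, φ, hκ0, hκu, hker, hdual, hloc, hz⟩ := hKdefσ W htow hadd hc ht P hN hlat hman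
  refine ⟨ι, κK, Λ, φ, hκ0, hκu, hker, hdual, fun j r Ψ hΨ => ?_, hz⟩
  obtain ⟨Λ₀', M', φ', ς, hΛ₀', h0, hu', hM', hlat', hres', hdef'⟩ := hloc j r Ψ hΨ
  refine ⟨Λ₀', M', hΛ₀', h0, hu', hM', ?_⟩
  intro Ψ' hΨ' y κ₀ h hres hlocκ w
  -- `Place.Completion (Sum.inr v₀)` is `v₀.adicCompletion ℚ` by `rfl`: read the FLT packet's algebra
  -- structure on it (w2-acc5's theorems are typed over `Place.Completion`)
  letI instEF : Algebra (NumberField.Place.Completion (K := ℚ) (Sum.inr ((Rat.HeightOneSpectrum.primesEquiv (R := 𝓞 ℚ)).symm ⟨3, Fact.out⟩)))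
      (w.1.adicCompletion (CyclotomicField (cycLevel 3 0 r) ℚ)) :=
    inferInstanceAs (Algebra (((Rat.HeightOneSpectrum.primesEquiv (R := 𝓞 ℚ)).symm ⟨3, Fact.out⟩).adicCompletion ℚ) (w.1.adicCompletion (CyclotomicField (cycLevel 3 0 r) ℚ)))
  -- the `w`-component of `Λ_{0,r}` and the scalar `e₃ ∘ φ`, as additive maps into `L_w`
  let LF : H1 (tateRep W 3) (cycSubgroup 3 0 r) →+ w.1.adicCompletion (CyclotomicField (cycLevel 3 0 r) ℚ) :=
    (Pi.evalAddMonoidHom (fun w : ((Rat.HeightOneSpectrum.primesEquiv (R := 𝓞 ℚ)).symm ⟨3, Fact.out⟩).Extension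
        (𝓞 (CyclotomicField (cycLevel 3 0 r) ℚ)) => w.1.adicCompletion (CyclotomicField (cycLevel 3 0 r) ℚ)) w).comp
      (Ψ.toAddEquiv.toAddMonoidHom.comp (Λ 0 r).toAddMonoidHom)
  let e : (tateLocalRep W 3 (Sum.inr ((Rat.HeightOneSpectrum.primesEquiv (R := 𝓞 ℚ)).symm ⟨3, Fact.out⟩))).cohomology 1 →+ w.1.adicCompletion (CyclotomicField (cycLevel 3 0 r) ℚ) :=
    ((algebraMap (((Rat.HeightOneSpectrum.primesEquiv (R := 𝓞 ℚ)).symm ⟨3, Fact.out⟩).adicCompletion ℚ) (w.1.adicCompletion (CyclotomicField (cycLevel 3 0 r) ℚ))).toAddMonoidHom.comp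
      ((Padic.adicCompletionEquiv (𝓞 ℚ) ⟨3, Fact.out⟩).toRingEquiv.toAddMonoidHom)).comp φ
  have hLF : ∀ y, LF y = Ψ (Λ 0 r y) w := fun y => rfl
  have he : ∀ h, e h = algebraMap (((Rat.HeightOneSpectrum.primesEquiv (R := 𝓞 ℚ)).symm ⟨3, Fact.out⟩).adicCompletion ℚ) (w.1.adicCompletion (CyclotomicField (cycLevel 3 0 r) ℚ))
      (Padic.adicCompletionEquiv (𝓞 ℚ) ⟨3, Fact.out⟩ (φ h)) := fun h => rfl
  -- w2-acc5's per-factor Galois side for the TWISTED localisation `loc^{tower}_w ∘ conjMap (ς w)` (§1)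
  obtain ⟨y', hy'⟩ := exists_sub_eq_zsmul_apply_of_factorDef_conjMap W 3 j 0 r ((Rat.HeightOneSpectrum.primesEquiv (R := 𝓞 ℚ)).symm ⟨3, Fact.out⟩)
    (w.1.adicCompletion (CyclotomicField (cycLevel 3 0 r) ℚ)) (ς w)
    (absGaloisRestrictTower_adicCompletion_mem_cycSubgroup r w) (φ' w) LF e
    (fun y φ'' hφ'' ψT hψT => by rw [hLF]; exact hdef' w y φ'' ψT hφ'' hψT)
    (fun h => by rw [he]; exact hres' w h) Ψ' hΨ' y κ₀ h hres hlocκ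
  refine ⟨φ' w y', hlat' w y', ?_⟩
  -- bookkeeping: `Ψ(φ h ⊗ 1 − 3⁰•Λ y)_w = e h − LF y = 3^{j+1} • φ_w y'`
  rw [pow_zero, one_smul, map_sub, Pi.sub_apply, hΨ, map_one, one_mul, ← he, ← hLF, hy', zsmul_eq_mul,
    Int.cast_pow, Int.cast_natCast]
  rfl


end Summit.BirchSwinnertonDyer.BirchSwinnertonDyer.Theorems.KimAtThreeFineKatoPerFactorDefinedTwist

end
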